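import Summits.NavierStokesRegularity.NavierStokesRegularity.Theses.AxisymmetricExtremality
import Summits.NavierStokesRegularity.NavierStokesRegularity.Theorems.AxisymmetricExtremalityAxisymmetricKatoGlobalNoSwirlStratum
import Summits.NavierStokesRegularity.NavierStokesRegularity.Theorems.AxisymmetricSwirlRegularity
import Literature.Analysis.FluidPDE.AxisymmetricReflection
import Literature.Barriers.NavierStokesRegularity.AxisymmetricTypeIExclusion
import HarnessLib

/-!
# Strategist census s17 — companion sketch for crux `AxisymmetricKatoGlobal`
(route `AxisymmetricExtremality`, item stmt-NavierStokesRegularity-15453)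

Kernel-checked statements backing `STRATEGY-CENSUS-s17.md` (independent census, family `-s`).
Nothing here restates or weakens the crux; these are the objects the census argues ABOUT:

* §0 `NoAxisymMinimalBlowupDatum` — the exact threshold INSTANCE of the crux that `closes`
  consumes (`closes_of_threshold`, `noAxisymMinimal_of_axisymmetricKatoGlobal`): a strictly
  weaker re-glue that is free but has no teeth (census §0, W-thr).
* §1 `MinimalDatumDihedral`, `DihedralToO2`, `no_O2_minimalBlowupDatum`, `closes_dihedral`,
  `summit_iff_minimalDatumDihedral` — the route-level bypass (census §0, W-O2): asking the Smith
  step for the dihedral 2-groups makes the crux DISPENSABLE, because an `O(2)`-equivariant datum is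
  swirl-free (`IsAxisymmetric.hasNoSwirl_of_reflY_eq`) and the no-swirl stratum of the crux is a
  THEOREM (`axisymmetricKatoGlobal_noSwirl_stratum`).
* §2 `FarFieldTransfer`, `axisymmetricKatoGlobal_of_subs` — the only honest typed decomposition
  (census `## Decomposition`), with its trivial seam exposed.
* §3 `LocalAxisRegularityBoundedSwirl` — the strengthening S⁺ (Seregin's local problem) as a
  signature (census `## Strengthen`).
-/

set_option linter.dupNamespace false

namespace Summit.NavierStokesRegularity.NavierStokesRegularity.Cruxes.AxisymmetricKatoGlobal.StrategistS17

open MeasureTheory Set Function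
open scoped ENNReal
open Literature.Analysis.FluidPDE
open Summit.NavierStokesRegularity.NavierStokesRegularity.Theses.AxisymmetricExtremality
open Summit.NavierStokesRegularity.NavierStokesRegularity.Theorems.AxisymmetricKatoGlobal.NoSwirlStratum

/-! ## §0  The threshold instance actually consumed by `closes` -/

/-- W-thr: no axisymmetric Rusin–Šverák minimal blow-up datum (axisymmetry unfolded exactly as in
the route file). This is all `closes` uses of `AxisymmetricKatoGlobal`. -/
def NoAxisymMinimalBlowupDatum : Prop :=
  ∀ ν : ℝ, 0 < ν → ∀ (u₀ : EuclideanSpace ℝ (Fin 3) → EuclideanSpace ℝ (Fin 3))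
    (g : Literature.Analysis.FunctionSpaces.HomSobolev (EuclideanSpace ℝ (Fin 3)) (EuclideanSpace ℂ (Fin 3)) (1 / 2 : ℝ)),
    IsMinimalBlowupDatum ν u₀ g →
    (∀ (θ : ℝ) (x : EuclideanSpace ℝ (Fin 3)), u₀ (WithLp.toLp 2 ![Real.cos θ * x 0 - Real.sin θ * x 1, Real.sin θ * x 0 + Real.cos θ * x 1, x 2]) = WithLp.toLp 2 ![Real.cos θ * u₀ x 0 - Real.sin θ * u₀ x 1, Real.sin θ * u₀ x 0 + Real.cos θ * u₀ x 1, u₀ x 2]) →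
    False

/-- The crux implies its threshold instance (pure logic). -/
theorem noAxisymMinimal_of_axisymmetricKatoGlobal (h : AxisymmetricKatoGlobal) :
    NoAxisymMinimalBlowupDatum := by
  intro ν hν u₀ g hmin hax
  obtain ⟨hL3, hrep, hdiv, -, hnot⟩ := hmin
  exact hnot (h ν hν u₀ g hL3 hrep hdiv hax)

/-- The deciding theorem re-glued on the threshold instance: same proof as the route's `closes`. -/
theorem closes_of_threshold (h₂ : MinimalDatumPFold) (h₄ : PFoldToAxisymmetric)
    (h₃ : NoAxisymMinimalBlowupDatum) : NavierStokesRegularity := by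
  show Literature.NS.NavierStokesExistenceSmoothR3
  intro ν hν u₀ hsm hdiv hdec
  by_contra hno
  obtain ⟨u₁, g, hmin, hax⟩ := h₄ ν hν (h₂ ν hν ⟨u₀, hsm, hdiv, hdec, hno⟩)
  exact h₃ ν hν u₁ g hmin hax

/-! ## §1  The dihedral / `O(2)` bypass: the crux is dispensable at route level -/

/-- The meridian reflection `σ (x₀,x₁,x₂) = (x₀,−x₁,x₂)` of the tree (`reflY`) is literally the
map written out below (so the unfolded clauses are `σ`-equivariance). -/
theorem reflY_eq (x : EuclideanSpace ℝ (Fin 3)) :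
    reflY x = WithLp.toLp 2 ![x 0, -x 1, x 2] := rfl

/-- `MinimalDatumDihedral`: the Smith step asked for the dihedral groups `D_p = ⟨R_{2π/p}, σ⟩`
instead of the cyclic groups `Z_p`: Clay failure at `ν` ⇒ for every `N` some `p ≥ max(N,2)` and a
minimal blow-up datum equivariant under `R_{2π/p}` AND under the meridian reflection `σ`
(both unfolded). For `p = 2^k` the price in Smith theory is `F₂`-acyclicity of `M̂ = M/Sim`, the
same as for `Z_{2^k}` (P. A. Smith; Allday–Puppe Cor. 1.4.7); strengthening of `MinimalDatumPFold`
(`minimalDatumPFold_of_dihedral`). -/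
def MinimalDatumDihedral : Prop :=
  ∀ ν : ℝ, 0 < ν → (∃ v₀ : EuclideanSpace ℝ (Fin 3) → EuclideanSpace ℝ (Fin 3), ContDiff ℝ (⊤ : ℕ∞) v₀ ∧ Literature.Analysis.FluidPDE.NSWave0.IsDivFree v₀ ∧ Literature.Analysis.FluidPDE.HasRapidSpatialDecay v₀ ∧ ¬ ∃ (u : ℝ → EuclideanSpace ℝ (Fin 3) → EuclideanSpace ℝ (Fin 3)) (p : ℝ → EuclideanSpace ℝ (Fin 3) → ℝ), Literature.Analysis.FluidPDE.IsSmoothOnHalfSpace u ∧ Literature.Analysis.FluidPDE.IsSmoothOnHalfSpace p ∧ Literature.Analysis.FluidPDE.IsNavierStokesSolution ν 0 v₀ u p ∧ Literature.Analysis.FluidPDE.HasBoundedEnergy u) →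
    ∀ N : ℕ, ∃ p : ℕ, N ≤ p ∧ 2 ≤ p ∧ ∃ (u₀ : EuclideanSpace ℝ (Fin 3) → EuclideanSpace ℝ (Fin 3)) (g : Literature.Analysis.FunctionSpaces.HomSobolev (EuclideanSpace ℝ (Fin 3)) (EuclideanSpace ℂ (Fin 3)) (1 / 2 : ℝ)),
      IsMinimalBlowupDatum ν u₀ g ∧
      (∀ x : EuclideanSpace ℝ (Fin 3), u₀ (WithLp.toLp 2 ![Real.cos (2 * Real.pi / p) * x 0 - Real.sin (2 * Real.pi / p) * x 1, Real.sin (2 * Real.pi / p) * x 0 + Real.cos (2 * Real.pi / p) * x 1, x 2]) = WithLp.toLp 2 ![Real.cos (2 * Real.pi / p) * u₀ x 0 - Real.sin (2 * Real.pi / p) * u₀ x 1, Real.sin (2 * Real.pi / p) * u₀ x 0 + Real.cos (2 * Real.pi / p) * u₀ x 1, u₀ x 2]) ∧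
      (∀ x : EuclideanSpace ℝ (Fin 3), u₀ (WithLp.toLp 2 ![x 0, -x 1, x 2]) = WithLp.toLp 2 ![u₀ x 0, -(u₀ x 1), u₀ x 2])

/-- `DihedralToO2`: the compactness upgrade for dihedral data (the analogue of the PROVED
`PFoldToAxisymmetric`): `D_{p_j}`-equivariant minimal blow-up data for unboundedly many `p_j` ⇒ an
`O(2)`-equivariant one (equivariant under every `R_θ` and under `σ`). Proof plan = the landed
axis-pinning / dense-angle-closure argument plus alignment of one reflection plane by a rotation
about the pinned axis (rotations act on `M`). -/
def DihedralToO2 : Prop :=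
  ∀ ν : ℝ, 0 < ν →
    (∀ N : ℕ, ∃ p : ℕ, N ≤ p ∧ 2 ≤ p ∧ ∃ (u₀ : EuclideanSpace ℝ (Fin 3) → EuclideanSpace ℝ (Fin 3)) (g : Literature.Analysis.FunctionSpaces.HomSobolev (EuclideanSpace ℝ (Fin 3)) (EuclideanSpace ℂ (Fin 3)) (1 / 2 : ℝ)),
      IsMinimalBlowupDatum ν u₀ g ∧
      (∀ x : EuclideanSpace ℝ (Fin 3), u₀ (WithLp.toLp 2 ![Real.cos (2 * Real.pi / p) * x 0 - Real.sin (2 * Real.pi / p) * x 1, Real.sin (2 * Real.pi / p) * x 0 + Real.cos (2 * Real.pi / p) * x 1, x 2]) = WithLp.toLp 2 ![Real.cos (2 * Real.pi / p) * u₀ x 0 - Real.sin (2 * Real.pi / p) * u₀ x 1, Real.sin (2 * Real.pi / p) * u₀ x 0 + Real.cos (2 * Real.pi / p) * u₀ x 1, u₀ x 2]) ∧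
      (∀ x : EuclideanSpace ℝ (Fin 3), u₀ (WithLp.toLp 2 ![x 0, -x 1, x 2]) = WithLp.toLp 2 ![u₀ x 0, -(u₀ x 1), u₀ x 2])) →
    ∃ (u₀ : EuclideanSpace ℝ (Fin 3) → EuclideanSpace ℝ (Fin 3)) (g : Literature.Analysis.FunctionSpaces.HomSobolev (EuclideanSpace ℝ (Fin 3)) (EuclideanSpace ℂ (Fin 3)) (1 / 2 : ℝ)),
      IsMinimalBlowupDatum ν u₀ g ∧
      (∀ (θ : ℝ) (x : EuclideanSpace ℝ (Fin 3)), u₀ (WithLp.toLp 2 ![Real.cos θ * x 0 - Real.sin θ * x 1, Real.sin θ * x 0 + Real.cos θ * x 1, x 2]) = WithLp.toLp 2 ![Real.cos θ * u₀ x 0 - Real.sin θ * u₀ x 1, Real.sin θ * u₀ x 0 + Real.cos θ * u₀ x 1, u₀ x 2]) ∧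
      (∀ x : EuclideanSpace ℝ (Fin 3), u₀ (WithLp.toLp 2 ![x 0, -x 1, x 2]) = WithLp.toLp 2 ![u₀ x 0, -(u₀ x 1), u₀ x 2])

/-- Dihedral data are in particular `p`-fold data: `MinimalDatumDihedral` strengthens the route's
`MinimalDatumPFold`. -/
theorem minimalDatumPFold_of_dihedral (h : MinimalDatumDihedral) : MinimalDatumPFold := by
  intro ν hν hfail N
  obtain ⟨p, hNp, h2p, u₀, g, hmin, hrot, -⟩ := h ν hν hfail N
  exact ⟨p, hNp, h2p, u₀, g, hmin, hrot⟩

/-- **No `O(2)`-equivariant minimal blow-up datum exists** — UNCONDITIONAL, from landed tree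
theorems only: `σ`-equivariance of an axisymmetric field kills the swirl
(`IsAxisymmetric.hasNoSwirl_of_reflY_eq`, Majda–Bertozzi §2.3.3), and axisymmetric swirl-free
critical data are Kato-global (`axisymmetricKatoGlobal_noSwirl_stratum`, the proved no-swirl
stratum of the crux), contradicting the minimality clause `¬ HasGlobalKatoSolution`. -/
theorem no_O2_minimalBlowupDatum (ν : ℝ) (hν : 0 < ν)
    (u₀ : EuclideanSpace ℝ (Fin 3) → EuclideanSpace ℝ (Fin 3))
    (g : Literature.Analysis.FunctionSpaces.HomSobolev (EuclideanSpace ℝ (Fin 3)) (EuclideanSpace ℂ (Fin 3)) (1 / 2 : ℝ))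
    (hmin : IsMinimalBlowupDatum ν u₀ g)
    (hrot : ∀ (θ : ℝ) (x : EuclideanSpace ℝ (Fin 3)), u₀ (WithLp.toLp 2 ![Real.cos θ * x 0 - Real.sin θ * x 1, Real.sin θ * x 0 + Real.cos θ * x 1, x 2]) = WithLp.toLp 2 ![Real.cos θ * u₀ x 0 - Real.sin θ * u₀ x 1, Real.sin θ * u₀ x 0 + Real.cos θ * u₀ x 1, u₀ x 2])
    (hσ : ∀ x : EuclideanSpace ℝ (Fin 3), u₀ (WithLp.toLp 2 ![x 0, -x 1, x 2]) = WithLp.toLp 2 ![u₀ x 0, -(u₀ x 1), u₀ x 2]) :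
    False := by
  obtain ⟨hL3, -, hdiv, -, hnot⟩ := hmin
  have hax : IsAxisymmetric u₀ := fun θ x => hrot θ x
  have hsw : HasNoSwirl u₀ := hax.hasNoSwirl_of_reflY_eq fun x => hσ x
  exact hnot (axisymmetricKatoGlobal_noSwirl_stratum ν hν u₀ hL3 hdiv (fun θ x => hrot θ x) hsw)

/-- **The re-glued deciding theorem without `AxisymmetricKatoGlobal`**: dihedral Smith output +
dihedral compactness upgrade ⇒ the summit (pure logic + `no_O2_minimalBlowupDatum`). -/
theorem closes_dihedral (h₂ : MinimalDatumDihedral) (h₄ : DihedralToO2) : NavierStokesRegularity := by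
  show Literature.NS.NavierStokesExistenceSmoothR3
  intro ν hν u₀ hsm hdiv hdec
  by_contra hno
  obtain ⟨u₁, g, hmin, hrot, hσ⟩ := h₄ ν hν (h₂ ν hν ⟨u₀, hsm, hdiv, hdec, hno⟩)
  exact no_O2_minimalBlowupDatum ν hν u₁ g hmin hrot hσ

/-- Under the summit the Clay-failure antecedent is unsatisfiable, so `MinimalDatumDihedral` holds
vacuously (same as `MinimalDatumPFold.Negative.cruxBody_of_navierStokesRegularity`). -/
theorem minimalDatumDihedral_of_summit (hS : NavierStokesRegularity) : MinimalDatumDihedral := by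
  have hS' : Literature.NS.NavierStokesExistenceSmoothR3 := hS
  intro ν hν hfail N
  obtain ⟨v₀, hsm, hdiv, hdec, hno⟩ := hfail
  exact (hno (hS' ν hν v₀ hsm hdiv hdec)).elim

/-- Honest strength bookkeeping for the bypass: GIVEN the (M-sized) compactness upgrade
`DihedralToO2`, the single remaining open crux `MinimalDatumDihedral` is EQUIVALENT to the summit —
exactly as `MinimalDatumPFold ∧ AxisymmetricKatoGlobal` is today
(`stub_summitIffMinimalDatumPFoldAnd`), but with one open crux instead of two. -/
theorem summit_iff_minimalDatumDihedral (h₄ : DihedralToO2) :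
    NavierStokesRegularity ↔ MinimalDatumDihedral :=
  ⟨minimalDatumDihedral_of_summit, fun h₂ => closes_dihedral h₂ h₄⟩

/-! ## §2  The only honest typed decomposition of the crux (bridge split, trivial seam) -/

/-- Piece 2 of decomposition D-a: the FAR-FIELD / ROUGHNESS TRANSFER from the Clay-class conjecture
leaf `AxisymmetricSwirlRegularity` (ns.S25: smooth, divergence-free, rapidly decaying axisymmetric
data have global classical bounded-energy solutions) to the critical-class crux (L³ data
represented in `Ḣ^{1/2}`, infinite energy allowed, swirl `Γ = r u_θ` possibly unbounded at
spatial infinity). No theorem in print supplies it (local-in-space regularity is short-time only). -/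
def FarFieldTransfer : Prop :=
  AxisymmetricSwirlRegularity → AxisymmetricKatoGlobal

/-- Assembly of D-a (modus ponens; `trivial_seam`). Piece 1 is the named open conjecture ns.S25
itself, so the split has no plan for its hard half and is NOT a redirect (census `## Decomposition`). -/
theorem axisymmetricKatoGlobal_of_subs (h₁ : AxisymmetricSwirlRegularity) (h₂ : FarFieldTransfer) :
    AxisymmetricKatoGlobal :=
  h₂ h₁

/-! ## §3  The strengthening S⁺: Seregin's local axis-regularity problem with bounded swirl -/

/-- S⁺ = LAR (local axis regularity under bounded swirl), typed over the vocabulary of the barrier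
`Literature.Barriers.NavierStokesRegularity.AxisymmetricTypeIExclusion` (Seregin–Šverák unit
cylinder `Q = 𝒞 × ]-1,0[`, `ν = 1`): a suitable weak solution in `Q` with `u ∈ L³(Q)`,
`p ∈ L^{3/2}(Q)`, axisymmetric slices, swirl `|Γ| = |x₀u₁ − x₁u₀| ≤ M` a.e. in `Q`, and essentially
bounded below every `t = -ε`, is regular at the origin. The Type I hypothesis of the barrier is
REPLACED by bounded swirl: this is the standing open problem of Seregin 2020/2022/2024 (known only
under smallness or a modulus of `Γ` at the axis: CFZ2017, LeiZhang2017, Wei2016, Seregin 2022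
`ln⁻³`, arXiv:2109.09344). It implies the crux via the landed local-energy framing of the registered
line (stub_katoLocalEnergyNearTop, stub_offAxisBounded_of_localEnergy, swirl max principle) but
buys nothing: the added rigidity (local setting, `Γ ∈ L^∞`, smoothness below the top) is exactly
the classical setting in which the problem has been open since 1968. Signature only. -/
def LocalAxisRegularityBoundedSwirl : Prop :=
  ∀ (u : ℝ → EuclideanSpace ℝ (Fin 3) → EuclideanSpace ℝ (Fin 3)) (p : ℝ → EuclideanSpace ℝ (Fin 3) → ℝ),
    IsSuitableWeakSolutionOn Literature.Barriers.NavierStokesRegularity.ssCylinderOpens 1 0 u p →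
    (∫⁻ z in Literature.Barriers.NavierStokesRegularity.ssCylinder, ‖u z.1 z.2‖ₑ ^ (3 : ℕ) < ∞) →
    (∫⁻ z in Literature.Barriers.NavierStokesRegularity.ssCylinder, ‖p z.1 z.2‖ₑ ^ (3 / 2 : ℝ) < ∞) →
    (∀ t ∈ Ioo (-1 : ℝ) 0, IsAxisymmetric (u t)) →
    (∃ M : ℝ, ∀ᵐ z ∂(volume.restrict Literature.Barriers.NavierStokesRegularity.ssCylinder), |swirl (u z.1) z.2| ≤ M) →
    (∀ ε : ℝ, 0 < ε → eLpNorm (uncurry u) ∞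
        (volume.restrict (Literature.Barriers.NavierStokesRegularity.ssCylinder ∩ {z | z.1 < -ε})) < ∞) →
    ∃ r > 0, eLpNorm (uncurry u) ∞ (volume.restrict (parabolicCylinder r ((0 : ℝ), (0 : EuclideanSpace ℝ (Fin 3))))) < ∞

end Summit.NavierStokesRegularity.NavierStokesRegularity.Cruxes.AxisymmetricKatoGlobal.StrategistS17
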